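import Mathlib
import Literature.LinearAlgebra.Matrix.CrossInterpolation
import Literature.LinearAlgebra.Matrix.SchurComplementQuotient
import Literature.LinearAlgebra.Matrix.MaximalVolumeErrorBounds

/-!
# Adaptive cross approximation: the rank-one update and the `2^k` bound under partial pivoting

ADAPTIVE CROSS APPROXIMATION (ACA) of [Bebendorf2000, §2] builds the cross (skeleton)
interpolation `Ã = s_k = A[:, c] P⁻¹ A[r, :]` (`Literature.LinearAlgebra.Matrix.crossInterp`,
pivot block `P = M_k = A[r, c]`; [Bebendorf2000, Lemma 3]) one pivot at a time: with the residual
`r_k = A - s_k`, a new pivot `(i, j) = (x_{i_{k+1}}, y_{j_{k+1}})` with `r_k(i, j) ≠ 0` gives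
`r_{k+1} = r_k - r_k(·, j) r_k(i, j)⁻¹ r_k(i, ·)`.  Choosing the new pivot row by PARTIAL
PIVOTING — `|r_k(i, j)| ≥ |r_k(x, j)|` for all rows `x`, the column `j` being arbitrary — keeps the
coefficients `det M_k^{(l)}(x) / det M_k` of the error representation [Bebendorf2000, Lemma 5]
below `2^{k-l}` [Bebendorf2000, Lemma 6] and yields the error estimate [Bebendorf2000, (6)]
(`|r_k| ≤ 2^k sup |E|`, `E` the error of any approximation from the pivot columns, there
polynomial interpolation); the same analysis is [Steinbach2008, §14.2.3, Lemmas 14.9–14.14,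
Corollaries 14.13, 14.15].  The two-sided version of the pivoting rule is the pair of ROOK
CONDITIONS of partial rank-revealing LU [NunezFernandezEtAl2025, §3.3.1, App. B.2].  This file
formalises, for matrices over a commutative ring (identities) or a normed field (bounds), with
the pivot lists `r, c : Fin k → _` read NEWEST PIVOT FIRST (`vecCons`; position `s` from the
front is Bebendorf's `l = k - s`):

* `crossInterp_vecCons_vecCons_apply`, `sub_crossInterp_vecCons_vecCons_apply` — the ACA
  recursion for `s_{k+1}` and `r_{k+1}` [Bebendorf2000, §2; Steinbach2008, (14.26)–(14.27)],
  derived here from the definition `Ã = A[:, c] P⁻¹ A[r, :]` (so [Bebendorf2000, Lemma 3] —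
  the recursion computes the cross interpolation — holds by construction);
  `sub_crossInterp_apply_pivotCol/Row` — the residual vanishes on the pivot cross
  [Bebendorf2000, Lemma 1]; `isUnit_det_submatrix_vecCons_vecCons_iff` — `M_{k+1}` is
  nonsingular iff the new pivot residual is a unit [Bebendorf2000, Lemma 2], the identity
  `det M_{k+1} = det M_k · r_k(i, j)` being
  `Literature.LinearAlgebra.Matrix.det_submatrix_vecCons_vecCons`;
* `submatrix_mul_inv_submatrix_vecCons_vecCons` (`_apply_zero`, `_apply_succ`) and the row
  versions `inv_submatrix_mul_submatrix_vecCons_vecCons_apply_zero/succ` — the update of the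
  COEFFICIENT MATRICES `C = A[:, c] P⁻¹` (entries `det M_k^{(l)}(x) / det M_k` by Cramer's rule)
  and `P⁻¹ A[r, :]`: `C' x 0 = r_k(x, j) / r_k(i, j)`, `C' x (s+1) = C x s - (r_k(x, j) / r_k(i, j))
  C i s` — [Bebendorf2000, Lemma 2] divided by `det M_{k+1}`, as used in the proof of
  [Bebendorf2000, Lemma 6] and [Steinbach2008, Lemma 14.14];
* `sub_crossInterp_apply_eq_sub_sum` — the ERROR REPRESENTATION [Bebendorf2000, Lemma 5],
  [Steinbach2008, Lemma 14.12]: `r = e(x, ·) - Σ_l C x l · e(r l, ·)` for the error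
  `e = A - A[:, c] L` of ANY approximation with coefficients `L` from the pivot columns, and its
  normed consequence `norm_sub_crossInterp_le_of_norm_submatrix_mul_inv_le`
  (`‖r(x, y)‖ ≤ (1 + Σ_l γ_l) δ` if `‖C x l‖ ≤ γ_l`), of which [Bebendorf2000, (5)] (maximal
  volume, `γ_l = 1`) and [Bebendorf2000, (6)] (partial pivoting, `γ_l = 2^{k-l}`) are the cases;
* `IsColumnPivoted` (partial pivoting in the sense of [Bebendorf2000, Lemma 6],
  [Steinbach2008, (14.33)]), `IsRowPivoted`, `IsRookPivoted` (both: the rook conditions of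
  [NunezFernandezEtAl2025, App. B.2]; full pivoting is the special case
  `IsRookPivoted.cons_of_forall`) — inductive predicates on pivot sequences;
* `IsColumnPivoted.norm_submatrix_mul_inv_apply_le_two_pow` — THE GROWTH BOUND
  [Bebendorf2000, Lemma 6], [Steinbach2008, Lemma 14.14]: `‖C x s‖ ≤ 2^s`; row sums
  `≤ 2^k - 1`; the transposed `IsRowPivoted.norm_inv_submatrix_mul_apply_le_two_pow` and the
  two-sided `IsRookPivoted.norm_coeff_le_two_pow`; `norm_det_submatrix_vecCons_vecCons_le` —
  the greedy row is the locally volume-maximal choice [Bebendorf2000, after (5)];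
* `IsColumnPivoted.norm_sub_crossInterp_le`, `IsRowPivoted.norm_sub_crossInterp_le` — THE ACA
  ERROR ESTIMATE [Bebendorf2000, (6)], [Steinbach2008, Cor. 14.15]: `‖(A - Ã) x y‖ ≤ 2^k δ`
  (with `1 + Σ_{l ≤ k} 2^{k-l} = 2^k`; [Bebendorf2000, (6)] prints the constant `1 + 2^{n_p}`).

NOT formalised: the convergence analysis for asymptotically smooth kernels ([Bebendorf2000,
§3, Thm 4] via multivariate interpolation estimates, Thm 3), stopping criteria, complexity
counts, the sharpness of `2^k`, and any search procedure for the pivots (the predicates record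
the outcome of a search, not an algorithm).

References: M. Bebendorf, *Approximation of boundary element matrices*, Numer. Math. 86 (2000)
565–589, §2 (Lemmas 1–3, 5, 6, eqs. (4)–(6)); O. Steinbach, *Numerical Approximation Methods for
Elliptic Boundary Value Problems*, Springer 2008, §14.2.3 (Lemmas 14.9–14.12, 14.14,
Corollaries 14.13, 14.15); Y. Núñez Fernández et al., *Learning tensor networks with tensor cross
interpolation: new algorithms and libraries*, SciPost Phys. 18 (2025) 104 (arXiv:2407.02454),
§3.3.1 and App. B.2.
AI-produced formalisation (H21 engines group, seat eng-quad-2, 2026-08-21); no facts, no axioms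
beyond Mathlib's, no `sorry`.
-/

open Matrix

namespace Literature.LinearAlgebra.Matrix

/-! ## The ACA recursion: one new pivot `(i, j)` updates `Ã`, the residual and the coefficients -/

section CommRing

variable {K : Type*} [CommRing K] {m n ι : Type*} [Fintype ι] [DecidableEq ι] {k : ℕ}

/-- [cite: Bebendorf2000, §2 Lemma 3] The cross interpolation `s_k = f(x,[y]_k)ᵀ M_k⁻¹ f([x]_k,y)`
is symmetric in the roles of rows and columns: `(Ã)ᵀ` is the cross interpolation of `Aᵀ` on the
swapped pivots. -/
theorem transpose_crossInterp (A : Matrix m n K) (r : ι → m) (c : ι → n) :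
    (crossInterp A r c)ᵀ = crossInterp Aᵀ c r := by
  simp only [crossInterp_def, transpose_mul, transpose_nonsing_inv, transpose_submatrix,
    Matrix.mul_assoc]

/-- [cite: Bebendorf2000, §2 Lemma 3] Entry form of `transpose_crossInterp` for the residual:
`(Aᵀ - crossInterp Aᵀ c r) y x = (A - crossInterp A r c) x y`. -/
theorem transpose_sub_crossInterp_apply (A : Matrix m n K) (r : ι → m) (c : ι → n) (x : m)
    (y : n) : (Aᵀ - crossInterp Aᵀ c r) y x = (A - crossInterp A r c) x y := by
  rw [← transpose_crossInterp, ← transpose_sub, transpose_apply]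

/-- [cite: Bebendorf2000, §2 Lemma 3]; [cite: NunezFernandezEtAl2025, §3.1] The entries of
`Ã = C R`, `C = A[:, c] P⁻¹` the COLUMN COEFFICIENT MATRIX (`C x l = det M^{(l)}(x) / det M` by
Cramer's rule, `Literature.LinearAlgebra.Matrix.mul_inv_submatrix_apply_mul_det`),
`R = A[r, :]`: `Ã x y = Σ_s C x s · A (r s) y`. -/
theorem crossInterp_apply_eq_sum (A : Matrix m n K) (r : ι → m) (c : ι → n) (x : m) (y : n) :
    crossInterp A r c x y = ∑ s, (A.submatrix id c * (A.submatrix r c)⁻¹) x s * A (r s) y := by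
  rw [crossInterp_def, Matrix.mul_apply]
  rfl

/-- [cite: NunezFernandezEtAl2025, §3.1 property (ii)] `C P = A[:, c]` entrywise:
`Σ_s C x s · A (r s) (c t) = A x (c t)` (the interpolation reproduces the pivot columns). -/
theorem sum_submatrix_mul_inv_apply_mul_apply_pivotCol (A : Matrix m n K) {r : ι → m}
    {c : ι → n} (hP : IsUnit (A.submatrix r c).det) (x : m) (t : ι) :
    ∑ s, (A.submatrix id c * (A.submatrix r c)⁻¹) x s * A (r s) (c t) = A x (c t) := by
  rw [← crossInterp_apply_eq_sum, crossInterp_apply_pivotCol A hP]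

/-- [cite: Bebendorf2000, §2 Lemma 1]; [cite: Steinbach2008, §14.2.3 Lemma 14.9] The residual
`r_k = A - Ã` vanishes on the pivot columns (and, by `transpose_sub_crossInterp_apply`, on the
pivot rows). -/
theorem sub_crossInterp_apply_pivotCol (A : Matrix m n K) {r : ι → m} {c : ι → n}
    (hP : IsUnit (A.submatrix r c).det) (x : m) (t : ι) :
    (A - crossInterp A r c) x (c t) = 0 := by
  rw [Matrix.sub_apply, crossInterp_apply_pivotCol A hP, sub_self]

/-- [cite: Bebendorf2000, §2 Lemma 1 ("the same statement holds if we interchange the roles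
of `x` and `y`")]; [cite: Steinbach2008, §14.2.3 Lemma 14.9] The residual `r_k = A - Ã`
vanishes on the pivot rows. -/
theorem sub_crossInterp_apply_pivotRow (A : Matrix m n K) {r : ι → m} {c : ι → n}
    (hP : IsUnit (A.submatrix r c).det) (t : ι) (y : n) :
    (A - crossInterp A r c) (r t) y = 0 := by
  rw [Matrix.sub_apply, crossInterp_apply_pivotRow A hP, sub_self]

/-- [cite: Bebendorf2000, §2 Lemma 2]; [cite: Steinbach2008, §14.2.3 Lemma 14.10]
`det M_{k+1} = det M_k · r_k(x_{i_{k+1}}, y_{j_{k+1}})`: given a nonsingular pivot block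
`P = A[r, c]`, the block bordered by the new pivot `(i, j)` is nonsingular iff the residual at
the new pivot, `(A - Ã) i j`, is a unit (the determinant identity itself is
`Literature.LinearAlgebra.Matrix.det_submatrix_vecCons_vecCons`). -/
theorem isUnit_det_submatrix_vecCons_vecCons_iff (A : Matrix m n K) (r : Fin k → m)
    (c : Fin k → n) (hP : IsUnit (A.submatrix r c).det) (i : m) (j : n) :
    IsUnit (A.submatrix (vecCons i r) (vecCons j c)).det ↔
      IsUnit ((A - crossInterp A r c) i j) := by
  rw [det_submatrix_vecCons_vecCons A r c hP i j]
  exact IsUnit.mul_iff.trans (and_iff_right hP)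

/-- [cite: Bebendorf2000, §2 Lemma 2, Lemma 6 (proof)]; [cite: Steinbach2008, §14.2.3
Lemma 14.10, Lemma 14.14 (proof)]
ONE ACA STEP ON THE COLUMN COEFFICIENTS.  Adjoin a new pivot `(i, j)` IN FRONT of the pivot
lists (`vecCons`, newest pivot at index `0`), with unit residual `γ⁻¹ = (A - Ã) i j`.  The new
column coefficient matrix `C' = A[:, (j, c)] (A[(i, r), (j, c)])⁻¹` is obtained from
`C = A[:, c] P⁻¹` and the residual column `E[:, j] = (A - Ã)[:, j]` by
`C' x 0 = E x j · γ` and `C' x (s+1) = C x s - E x j · γ · C i s`.  In the notation of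
[Bebendorf2000] (`C x l = det M^{(l)}(x) / det M` by Cramer's rule) this is Lemma 2,
`det M_k^{(l)}(x) = r_{k-1}(x_{i_k}, y_{j_k}) det M_{k-1}^{(l)}(x)
  - r_{k-1}(x, y_{j_k}) det M_{k-1}^{(l)}(x_{i_k})`, `det M_k^{(k)}(x) = r_{k-1}(x, y_{j_k})
det M_{k-1}`, divided by `det M_k = r_{k-1}(x_{i_k}, y_{j_k}) det M_{k-1}` — the form used in
the proof of Lemma 6.  Proof here: the right-hand side `X` satisfies
`X · A[(i, r), (j, c)] = A[:, (j, c)]`, and the bordered block is nonsingular. -/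
theorem submatrix_mul_inv_submatrix_vecCons_vecCons (A : Matrix m n K) (r : Fin k → m)
    (c : Fin k → n) (hP : IsUnit (A.submatrix r c).det) {i : m} {j : n}
    (hγ : IsUnit ((A - crossInterp A r c) i j)) :
    A.submatrix id (vecCons j c) * (A.submatrix (vecCons i r) (vecCons j c))⁻¹ =
      Matrix.of fun x => vecCons
        ((A - crossInterp A r c) x j * Ring.inverse ((A - crossInterp A r c) i j))
        fun s => (A.submatrix id c * (A.submatrix r c)⁻¹) x s -
          (A - crossInterp A r c) x j * Ring.inverse ((A - crossInterp A r c) i j) *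
            (A.submatrix id c * (A.submatrix r c)⁻¹) i s := by
  have hP' : IsUnit (A.submatrix (vecCons i r) (vecCons j c)).det :=
    (isUnit_det_submatrix_vecCons_vecCons_iff A r c hP i j).2 hγ
  have hγ1 : (A - crossInterp A r c) i j * Ring.inverse ((A - crossInterp A r c) i j) = 1 :=
    Ring.mul_inverse_cancel _ hγ
  -- the claimed matrix `X` satisfies `X · A[(i, r), (j, c)] = A[:, (j, c)]`
  have hX : (Matrix.of fun x => vecCons
      ((A - crossInterp A r c) x j * Ring.inverse ((A - crossInterp A r c) i j))
      fun s => (A.submatrix id c * (A.submatrix r c)⁻¹) x s -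
        (A - crossInterp A r c) x j * Ring.inverse ((A - crossInterp A r c) i j) *
          (A.submatrix id c * (A.submatrix r c)⁻¹) i s) *
        A.submatrix (vecCons i r) (vecCons j c) = A.submatrix id (vecCons j c) := by
    generalize Ring.inverse ((A - crossInterp A r c) i j) = u at hγ1 ⊢
    ext x t
    induction t using Fin.cases with
    | zero =>
      rw [Matrix.mul_apply, Fin.sum_univ_succ]
      simp only [of_apply, cons_val_zero, cons_val_succ, submatrix_apply, id_eq, sub_mul,
        Finset.sum_sub_distrib]
      have h2 : ∑ s, (A - crossInterp A r c) x j * u *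
          (A.submatrix id c * (A.submatrix r c)⁻¹) i s * A (r s) j =
            (A - crossInterp A r c) x j * u * crossInterp A r c i j := by
        rw [crossInterp_apply_eq_sum, Finset.mul_sum]
        exact Finset.sum_congr rfl fun s _ => by ring
      rw [← crossInterp_apply_eq_sum, h2]
      rw [Matrix.sub_apply] at hγ1
      simp only [Matrix.sub_apply]
      linear_combination (A x j - crossInterp A r c x j) * hγ1
    | succ t =>
      rw [Matrix.mul_apply, Fin.sum_univ_succ]
      simp only [of_apply, cons_val_zero, cons_val_succ, submatrix_apply, id_eq, sub_mul,
        Finset.sum_sub_distrib]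
      have h2 : ∑ s, (A - crossInterp A r c) x j * u *
          (A.submatrix id c * (A.submatrix r c)⁻¹) i s * A (r s) (c t) =
            (A - crossInterp A r c) x j * u * A i (c t) := by
        rw [← sum_submatrix_mul_inv_apply_mul_apply_pivotCol A hP i t, Finset.mul_sum]
        exact Finset.sum_congr rfl fun s _ => by ring
      rw [sum_submatrix_mul_inv_apply_mul_apply_pivotCol A hP x t, h2]
      ring
  rw [← hX]
  exact mul_nonsing_inv_cancel_right _ _ hP'

/-- [cite: Bebendorf2000, §2 Lemma 2, Lemma 6 (proof)]; [cite: Steinbach2008, §14.2.3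
Lemma 14.14 (proof)] The newest column coefficient: `C' x 0 = (A - Ã) x j · ((A - Ã) i j)⁻¹`,
i.e. `det M_k^{(k)}(x) / det M_k = r_{k-1}(x, y_{j_k}) / r_{k-1}(x_{i_k}, y_{j_k})`. -/
theorem submatrix_mul_inv_submatrix_vecCons_vecCons_apply_zero (A : Matrix m n K)
    (r : Fin k → m) (c : Fin k → n) (hP : IsUnit (A.submatrix r c).det) {i : m} {j : n}
    (hγ : IsUnit ((A - crossInterp A r c) i j)) (x : m) :
    (A.submatrix id (vecCons j c) * (A.submatrix (vecCons i r) (vecCons j c))⁻¹) x 0 =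
      (A - crossInterp A r c) x j * Ring.inverse ((A - crossInterp A r c) i j) := by
  rw [submatrix_mul_inv_submatrix_vecCons_vecCons A r c hP hγ]
  simp

/-- [cite: Bebendorf2000, §2 Lemma 2, Lemma 6 (proof)]; [cite: Steinbach2008, §14.2.3
Lemma 14.14 (proof)] The older column coefficients after one ACA step:
`C' x (s+1) = C x s - (A - Ã) x j · ((A - Ã) i j)⁻¹ · C i s`, i.e.
`det M_k^{(l)}(x) / det M_k = det M_{k-1}^{(l)}(x) / det M_{k-1}
  - (r_{k-1}(x, y_{j_k}) / r_{k-1}(x_{i_k}, y_{j_k})) · det M_{k-1}^{(l)}(x_{i_k}) / det M_{k-1}`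
(`1 ≤ l < k`). -/
theorem submatrix_mul_inv_submatrix_vecCons_vecCons_apply_succ (A : Matrix m n K)
    (r : Fin k → m) (c : Fin k → n) (hP : IsUnit (A.submatrix r c).det) {i : m} {j : n}
    (hγ : IsUnit ((A - crossInterp A r c) i j)) (x : m) (s : Fin k) :
    (A.submatrix id (vecCons j c) * (A.submatrix (vecCons i r) (vecCons j c))⁻¹) x s.succ =
      (A.submatrix id c * (A.submatrix r c)⁻¹) x s -
        (A - crossInterp A r c) x j * Ring.inverse ((A - crossInterp A r c) i j) *
          (A.submatrix id c * (A.submatrix r c)⁻¹) i s := by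
  rw [submatrix_mul_inv_submatrix_vecCons_vecCons A r c hP hγ]
  simp

/-- [cite: Bebendorf2000, §2 (recursion for `s_{k+1}`)]; [cite: Steinbach2008, §14.2.3 (14.27)];
[cite: NunezFernandezEtAl2025, §3.2 (adding a pivot)] THE ACA UPDATE OF THE APPROXIMANT:
adjoining the pivot `(i, j)` adds the rank-one cross of the residual through it,
`s_{k+1}(x, y) = s_k(x, y) + r_k(x, y_j) · r_k(x_i, y_j)⁻¹ · r_k(x_i, y)`. -/
theorem crossInterp_vecCons_vecCons_apply (A : Matrix m n K) (r : Fin k → m) (c : Fin k → n)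
    (hP : IsUnit (A.submatrix r c).det) {i : m} {j : n}
    (hγ : IsUnit ((A - crossInterp A r c) i j)) (x : m) (y : n) :
    crossInterp A (vecCons i r) (vecCons j c) x y = crossInterp A r c x y +
      (A - crossInterp A r c) x j * Ring.inverse ((A - crossInterp A r c) i j) *
        (A - crossInterp A r c) i y := by
  rw [crossInterp_apply_eq_sum, submatrix_mul_inv_submatrix_vecCons_vecCons A r c hP hγ,
    Fin.sum_univ_succ]
  simp only [of_apply, cons_val_zero, cons_val_succ, sub_mul, Finset.sum_sub_distrib]
  have h2 : ∑ s, (A - crossInterp A r c) x j * Ring.inverse ((A - crossInterp A r c) i j) *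
      (A.submatrix id c * (A.submatrix r c)⁻¹) i s * A (r s) y =
        (A - crossInterp A r c) x j * Ring.inverse ((A - crossInterp A r c) i j) *
          crossInterp A r c i y := by
    rw [crossInterp_apply_eq_sum A r c i y, Finset.mul_sum]
    exact Finset.sum_congr rfl fun s _ => by ring
  rw [← crossInterp_apply_eq_sum, h2, Matrix.sub_apply A (crossInterp A r c) i y]
  ring

/-- [cite: Bebendorf2000, §2 (definition of `r_{k+1}`)]; [cite: Steinbach2008, §14.2.3 (14.26)];
[cite: NunezFernandezEtAl2025, §3.3.1] THE ACA UPDATE OF THE RESIDUAL (one step of Gaussian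
elimination on the Schur complement):
`r_{k+1}(x, y) = r_k(x, y) - r_k(x, y_j) · r_k(x_i, y_j)⁻¹ · r_k(x_i, y)`. -/
theorem sub_crossInterp_vecCons_vecCons_apply (A : Matrix m n K) (r : Fin k → m)
    (c : Fin k → n) (hP : IsUnit (A.submatrix r c).det) {i : m} {j : n}
    (hγ : IsUnit ((A - crossInterp A r c) i j)) (x : m) (y : n) :
    (A - crossInterp A (vecCons i r) (vecCons j c)) x y = (A - crossInterp A r c) x y -
      (A - crossInterp A r c) x j * Ring.inverse ((A - crossInterp A r c) i j) *
        (A - crossInterp A r c) i y := by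
  rw [Matrix.sub_apply, crossInterp_vecCons_vecCons_apply A r c hP hγ,
    Matrix.sub_apply A (crossInterp A r c) x y]
  ring

/-! ### The row coefficients `P⁻¹ A[r, :]` (transposed statements) -/

/-- [cite: Bebendorf2000, §2 Lemma 3] The ROW COEFFICIENT MATRIX `P⁻¹ A[r, :]` of `A` is the
transpose of the column coefficient matrix of `Aᵀ` (pivots swapped). -/
theorem transpose_inv_submatrix_mul_submatrix (A : Matrix m n K) (r : ι → m) (c : ι → n) :
    ((A.submatrix r c)⁻¹ * A.submatrix r id)ᵀ = Aᵀ.submatrix id r * (Aᵀ.submatrix c r)⁻¹ := by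
  rw [transpose_mul, transpose_nonsing_inv, transpose_submatrix, transpose_submatrix]

/-- [cite: Bebendorf2000, §2 Lemma 2, Lemma 6 (proof), with the roles of `x` and `y`
interchanged] The newest ROW coefficient after one ACA step:
`(P'⁻¹ A[(i, r), :]) 0 y = ((A - Ã) i j)⁻¹ · (A - Ã) i y`. -/
theorem inv_submatrix_mul_submatrix_vecCons_vecCons_apply_zero (A : Matrix m n K)
    (r : Fin k → m) (c : Fin k → n) (hP : IsUnit (A.submatrix r c).det) {i : m} {j : n}
    (hγ : IsUnit ((A - crossInterp A r c) i j)) (y : n) :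
    ((A.submatrix (vecCons i r) (vecCons j c))⁻¹ * A.submatrix (vecCons i r) id) 0 y =
      Ring.inverse ((A - crossInterp A r c) i j) * (A - crossInterp A r c) i y := by
  have hPt : IsUnit (Aᵀ.submatrix c r).det := by
    rw [← transpose_submatrix, det_transpose]; exact hP
  have hγt : IsUnit ((Aᵀ - crossInterp Aᵀ c r) j i) := by
    rwa [transpose_sub_crossInterp_apply]
  rw [← transpose_apply ((A.submatrix (vecCons i r) (vecCons j c))⁻¹ * _) y 0,
    transpose_inv_submatrix_mul_submatrix,
    submatrix_mul_inv_submatrix_vecCons_vecCons_apply_zero Aᵀ c r hPt hγt y,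
    transpose_sub_crossInterp_apply, transpose_sub_crossInterp_apply, mul_comm]

/-- [cite: Bebendorf2000, §2 Lemma 2, Lemma 6 (proof), with the roles of `x` and `y`
interchanged] The older ROW coefficients after one ACA step: `(P'⁻¹ A[(i, r), :]) (s+1) y =
(P⁻¹ A[r, :]) s y - (P⁻¹ A[r, :]) s j · ((A - Ã) i j)⁻¹ · (A - Ã) i y`. -/
theorem inv_submatrix_mul_submatrix_vecCons_vecCons_apply_succ (A : Matrix m n K)
    (r : Fin k → m) (c : Fin k → n) (hP : IsUnit (A.submatrix r c).det) {i : m} {j : n}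
    (hγ : IsUnit ((A - crossInterp A r c) i j)) (s : Fin k) (y : n) :
    ((A.submatrix (vecCons i r) (vecCons j c))⁻¹ * A.submatrix (vecCons i r) id) s.succ y =
      ((A.submatrix r c)⁻¹ * A.submatrix r id) s y -
        ((A.submatrix r c)⁻¹ * A.submatrix r id) s j *
          Ring.inverse ((A - crossInterp A r c) i j) * (A - crossInterp A r c) i y := by
  have hPt : IsUnit (Aᵀ.submatrix c r).det := by
    rw [← transpose_submatrix, det_transpose]; exact hP
  have hγt : IsUnit ((Aᵀ - crossInterp Aᵀ c r) j i) := by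
    rwa [transpose_sub_crossInterp_apply]
  rw [← transpose_apply ((A.submatrix (vecCons i r) (vecCons j c))⁻¹ * _) y s.succ,
    transpose_inv_submatrix_mul_submatrix,
    submatrix_mul_inv_submatrix_vecCons_vecCons_apply_succ Aᵀ c r hPt hγt y s,
    transpose_sub_crossInterp_apply, transpose_sub_crossInterp_apply,
    ← transpose_inv_submatrix_mul_submatrix, transpose_apply, transpose_apply]
  ring

/-! ### The error decomposition against an arbitrary approximation from the pivot columns -/

/-- [cite: Bebendorf2000, §2 Lemma 5]; [cite: Steinbach2008, §14.2.3 Lemma 14.12]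
ERROR DECOMPOSITION.  For ANY approximation `A[:, c] L` of `A` built from its pivot columns
(coefficients `L : Matrix ι n K`; in [Bebendorf2000] the polynomial interpolation `I_p f_x` of
the kernel function in `y` at the pivot points `y_{j_1}, …, y_{j_k}`, with error
`E_p(f_x) = f_x - I_p f_x`), the cross-interpolation error is
`r(x, y) = e(x, y) - Σ_l C x l · e(r l, y)`, `e = A - A[:, c] L`, `C = A[:, c] P⁻¹`
(`C x l = det M^{(l)}(x) / det M`). -/
theorem sub_crossInterp_apply_eq_sub_sum (A : Matrix m n K) {r : ι → m} {c : ι → n}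
    (hP : IsUnit (A.submatrix r c).det) (L : Matrix ι n K) (x : m) (y : n) :
    (A - crossInterp A r c) x y = (A - A.submatrix id c * L) x y -
      ∑ l, (A.submatrix id c * (A.submatrix r c)⁻¹) x l * (A - A.submatrix id c * L) (r l) y := by
  have h1 := crossInterp_apply_eq_sum A r c x y
  have h2 : ∑ l, (A.submatrix id c * (A.submatrix r c)⁻¹) x l * (A.submatrix id c * L) (r l) y =
      (A.submatrix id c * L) x y := by
    have hM : A.submatrix id c * (A.submatrix r c)⁻¹ * (A.submatrix r c * L) =
        A.submatrix id c * L := by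
      rw [← Matrix.mul_assoc, nonsing_inv_mul_cancel_right _ _ hP]
    calc ∑ l, (A.submatrix id c * (A.submatrix r c)⁻¹) x l * (A.submatrix id c * L) (r l) y
        = ∑ l, (A.submatrix id c * (A.submatrix r c)⁻¹) x l * (A.submatrix r c * L) l y := by
          refine Finset.sum_congr rfl fun l _ => ?_
          simp [Matrix.mul_apply]
      _ = (A.submatrix id c * (A.submatrix r c)⁻¹ * (A.submatrix r c * L)) x y := by
          rw [Matrix.mul_apply]
      _ = (A.submatrix id c * L) x y := congr_fun (congr_fun hM x) y
  simp only [Matrix.sub_apply, mul_sub, Finset.sum_sub_distrib, ← h1, h2]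
  ring

end CommRing

/-! ## Partial pivoting: the `2^k` growth of the coefficients and the error estimate -/

section NormedField

variable {K : Type*} [NormedField K] {m n ι : Type*} [Fintype ι] [DecidableEq ι] {k : ℕ}

/-- [cite: Bebendorf2000, §2 (4)–(6)]; [cite: Steinbach2008, §14.2.3 Cor. 14.13, Cor. 14.15]
THE LEBESGUE-CONSTANT ESTIMATE behind both error bounds of [Bebendorf2000, §2]: if the column
coefficients at `x` are bounded, `‖C x l‖ ≤ γ_l`, and some approximation from the pivot columns
has error `≤ δ` at `x` and at the pivot rows (in `y`), then
`‖(A - Ã) x y‖ ≤ (1 + Σ_l γ_l) δ`; `γ_l = 1` (maximal volume) is [Bebendorf2000, (5)]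
`(1 + n_p) sup E_p`, `γ_l = 2^{k-l}` (partial pivoting, Lemma 6) is [Bebendorf2000, (6)]. -/
theorem norm_sub_crossInterp_le_of_norm_submatrix_mul_inv_le (A : Matrix m n K) {r : ι → m}
    {c : ι → n} (hP : IsUnit (A.submatrix r c).det) (L : Matrix ι n K) {x : m} {y : n}
    {γ : ι → ℝ} (hC : ∀ l, ‖(A.submatrix id c * (A.submatrix r c)⁻¹) x l‖ ≤ γ l) {δ : ℝ}
    (hx : ‖(A - A.submatrix id c * L) x y‖ ≤ δ)
    (hr : ∀ l, ‖(A - A.submatrix id c * L) (r l) y‖ ≤ δ) :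
    ‖(A - crossInterp A r c) x y‖ ≤ (1 + ∑ l, γ l) * δ := by
  rw [sub_crossInterp_apply_eq_sub_sum A hP L x y]
  calc ‖(A - A.submatrix id c * L) x y - ∑ l, (A.submatrix id c * (A.submatrix r c)⁻¹) x l *
        (A - A.submatrix id c * L) (r l) y‖
      ≤ ‖(A - A.submatrix id c * L) x y‖ + ∑ l, ‖(A.submatrix id c * (A.submatrix r c)⁻¹) x l *
        (A - A.submatrix id c * L) (r l) y‖ :=
        (norm_sub_le _ _).trans (by gcongr; exact norm_sum_le _ _)
    _ ≤ δ + ∑ l, γ l * δ := by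
        refine add_le_add hx (Finset.sum_le_sum fun l _ => ?_)
        rw [norm_mul]
        exact mul_le_mul (hC l) (hr l) (norm_nonneg _) ((norm_nonneg _).trans (hC l))
    _ = (1 + ∑ l, γ l) * δ := by rw [← Finset.sum_mul]; ring

/-- [cite: Bebendorf2000, §2 (after (5))] THE GREEDY PIVOT IS LOCALLY OF MAXIMAL VOLUME: if the
new pivot row `i` maximises the residual in the new pivot column `j`,
`‖(A - Ã) x j‖ ≤ ‖(A - Ã) i j‖` for all `x`, then among all blocks `A[(x, r), (j, c)]` obtained
by keeping the previous pivots and the new column fixed, `x = i` has the largest `‖det‖`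
("the best possible choice with respect to maximum determinants if we keep all other previously
chosen elements fixed", by Lemma 2). -/
theorem norm_det_submatrix_vecCons_vecCons_le (A : Matrix m n K) (r : Fin k → m)
    (c : Fin k → n) (hP : IsUnit (A.submatrix r c).det) {i : m} {j : n}
    (hcol : ∀ x, ‖(A - crossInterp A r c) x j‖ ≤ ‖(A - crossInterp A r c) i j‖) (x : m) :
    ‖(A.submatrix (vecCons x r) (vecCons j c)).det‖ ≤
      ‖(A.submatrix (vecCons i r) (vecCons j c)).det‖ := by
  rw [det_submatrix_vecCons_vecCons A r c hP x j, det_submatrix_vecCons_vecCons A r c hP i j,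
    norm_mul, norm_mul]
  exact mul_le_mul_of_nonneg_left (hcol x) (norm_nonneg _)

/-- [cite: Bebendorf2000, §2 Lemma 6 (hypothesis: `i_k` maximises `|r_{k-1}(·, y_{j_k})|`)];
[cite: Steinbach2008, §14.2.3 (14.33)]; [cite: NunezFernandezEtAl2025, App. B.2 (rook
condition on `i_r`), §3.3.1] COLUMN-PIVOTED (partially pivoted) pivot sequences.  The pivot lists
`r, c : Fin k → _` are read NEWEST FIRST (index `0` = the pivot found last); the sequence is
column-pivoted if it is built from the empty sequence by steps `(r, c) ↦ ((i, r), (j, c))` in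
which the residual `E = A - crossInterp A r c` of the current approximation is nonzero at the new
pivot and the new pivot row maximises the residual in the new pivot column:
`‖E x j‖ ≤ ‖E i j‖` for all rows `x` (ACA with partial pivoting; the column `j` is arbitrary). -/
inductive IsColumnPivoted (A : Matrix m n K) : ∀ {k : ℕ}, (Fin k → m) → (Fin k → n) → Prop
  /-- The empty pivot sequence is column-pivoted. [cite: Bebendorf2000, §2 Lemma 6] -/
  | nil : IsColumnPivoted A ![] ![]
  /-- Adjoining a pivot `(i, j)` with `0 ≠ ‖E i j‖ = max_x ‖E x j‖`, `E` the current residual.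
  [cite: Bebendorf2000, §2 Lemma 6] -/
  | cons {k : ℕ} {r : Fin k → m} {c : Fin k → n} {i : m} {j : n} :
      IsColumnPivoted A r c → (A - crossInterp A r c) i j ≠ 0 →
      (∀ x, ‖(A - crossInterp A r c) x j‖ ≤ ‖(A - crossInterp A r c) i j‖) →
      IsColumnPivoted A (vecCons i r) (vecCons j c)

/-- [cite: Bebendorf2000, §2 Lemma 2]; [cite: Steinbach2008, §14.2.3 Lemma 14.10] Along a
column-pivoted sequence every pivot block is nonsingular (`det M_k = Π_l r_{l-1}(x_l, y_l) ≠ 0`). -/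
theorem IsColumnPivoted.isUnit_det {A : Matrix m n K} {r : Fin k → m} {c : Fin k → n}
    (h : IsColumnPivoted A r c) : IsUnit (A.submatrix r c).det := by
  induction h with
  | nil => rw [det_isEmpty]; exact isUnit_one
  | cons h hne _ ih =>
    rw [det_submatrix_vecCons_vecCons _ _ _ ih]
    exact ih.mul (isUnit_iff_ne_zero.mpr hne)

/-- [cite: Bebendorf2000, §2 Lemma 6]; [cite: Steinbach2008, §14.2.3 Lemma 14.14]
THE `2^k` GROWTH BOUND UNDER PARTIAL PIVOTING.  Along a column-pivoted sequence of `k` pivots the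
column coefficients satisfy `‖(A[:, c] P⁻¹) x s‖ ≤ 2^s` for every row `x`, where `s` is the
position of the pivot counted from the newest (`s = 0`) — in the numbering of [Bebendorf2000]
(`l = k - s` = the order in which the pivots were found),
`sup_x |det M_k^{(l)}(x)| / |det M_k| ≤ 2^{k-l}`. -/
theorem IsColumnPivoted.norm_submatrix_mul_inv_apply_le_two_pow {A : Matrix m n K}
    {r : Fin k → m} {c : Fin k → n} (h : IsColumnPivoted A r c) (x : m) (s : Fin k) :
    ‖(A.submatrix id c * (A.submatrix r c)⁻¹) x s‖ ≤ 2 ^ (s : ℕ) := by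
  induction h generalizing x with
  | nil => exact s.elim0
  | @cons k r c i j h hne hcol ih =>
    have hP := h.isUnit_det
    have hγ : IsUnit ((A - crossInterp A r c) i j) := isUnit_iff_ne_zero.mpr hne
    have hu : ‖(A - crossInterp A r c) x j * Ring.inverse ((A - crossInterp A r c) i j)‖ ≤ 1 := by
      rw [Ring.inverse_eq_inv, norm_mul, norm_inv]
      exact mul_inv_le_one_of_le₀ (hcol x) (norm_nonneg _)
    induction s using Fin.cases with
    | zero =>
      rw [submatrix_mul_inv_submatrix_vecCons_vecCons_apply_zero A r c hP hγ x, Fin.val_zero,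
        pow_zero]
      exact hu
    | succ t =>
      rw [submatrix_mul_inv_submatrix_vecCons_vecCons_apply_succ A r c hP hγ x t, Fin.val_succ,
        pow_succ]
      calc ‖(A.submatrix id c * (A.submatrix r c)⁻¹) x t - (A - crossInterp A r c) x j *
            Ring.inverse ((A - crossInterp A r c) i j) *
              (A.submatrix id c * (A.submatrix r c)⁻¹) i t‖
          ≤ ‖(A.submatrix id c * (A.submatrix r c)⁻¹) x t‖ + ‖(A - crossInterp A r c) x j *
            Ring.inverse ((A - crossInterp A r c) i j)‖ *
              ‖(A.submatrix id c * (A.submatrix r c)⁻¹) i t‖ := by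
            rw [← norm_mul]; exact norm_sub_le _ _
        _ ≤ 2 ^ (t : ℕ) + 1 * 2 ^ (t : ℕ) :=
            add_le_add (ih x t) (mul_le_mul hu (ih i t) (norm_nonneg _) zero_le_one)
        _ = 2 ^ (t : ℕ) * 2 := by ring

/-- [folklore] `Σ_{s < k} 2^s = 2^k - 1`. -/
private theorem sum_two_pow_fin_eq (k : ℕ) : ∑ s : Fin k, (2 : ℝ) ^ (s : ℕ) = 2 ^ k - 1 := by
  rw [Fin.sum_univ_eq_sum_range (fun s => (2 : ℝ) ^ s) k, geom_sum_eq (by norm_num) k]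
  norm_num

/-- [cite: Bebendorf2000, §2 Lemma 6]; [cite: Steinbach2008, §14.2.3 Lemma 14.14] Row sums of
the column coefficient matrix under partial pivoting: `Σ_s ‖(A[:, c] P⁻¹) x s‖ ≤ 2^k - 1`. -/
theorem IsColumnPivoted.sum_norm_submatrix_mul_inv_apply_le {A : Matrix m n K} {r : Fin k → m}
    {c : Fin k → n} (h : IsColumnPivoted A r c) (x : m) :
    ∑ s, ‖(A.submatrix id c * (A.submatrix r c)⁻¹) x s‖ ≤ 2 ^ k - 1 := by
  rw [← sum_two_pow_fin_eq k]
  exact Finset.sum_le_sum fun s _ => h.norm_submatrix_mul_inv_apply_le_two_pow x s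

/-- [cite: Bebendorf2000, §2 (6)]; [cite: Steinbach2008, §14.2.3 Cor. 14.15]
THE ACA ERROR ESTIMATE UNDER PARTIAL PIVOTING: after `k` column-pivoted steps,
`‖(A - Ã) x y‖ ≤ 2^k · δ` whenever some approximation of `A` from its pivot columns
(`A[:, c] L`, any coefficients `L`; in [Bebendorf2000] the interpolation error `E_p(f_x)`) is
`δ`-accurate at `(x, y)` and at the pivot rows `(r l, y)` — [Bebendorf2000, (6)] with the
constant `1 + Σ_{l=1}^{k} 2^{k-l} = 2^k` (stated there as `1 + 2^{n_p}`). -/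
theorem IsColumnPivoted.norm_sub_crossInterp_le {A : Matrix m n K} {r : Fin k → m}
    {c : Fin k → n} (h : IsColumnPivoted A r c) (L : Matrix (Fin k) n K) {x : m} {y : n}
    {δ : ℝ} (hx : ‖(A - A.submatrix id c * L) x y‖ ≤ δ)
    (hr : ∀ l, ‖(A - A.submatrix id c * L) (r l) y‖ ≤ δ) :
    ‖(A - crossInterp A r c) x y‖ ≤ 2 ^ k * δ := by
  have h1 := norm_sub_crossInterp_le_of_norm_submatrix_mul_inv_le A h.isUnit_det L
    (fun l => h.norm_submatrix_mul_inv_apply_le_two_pow x l) hx hr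
  rwa [sum_two_pow_fin_eq, add_sub_cancel] at h1

/-! ### Row pivoting and rook pivoting (transposed and two-sided versions) -/

/-- [cite: NunezFernandezEtAl2025, App. B.2 (rook condition on `j_r`)]; [cite: Bebendorf2000,
§2 Lemma 6 (transposed)] ROW-PIVOTED pivot sequences: as `IsColumnPivoted`, with the new pivot
column maximising the residual in the new pivot row, `‖E i y‖ ≤ ‖E i j‖` for all columns `y`. -/
inductive IsRowPivoted (A : Matrix m n K) : ∀ {k : ℕ}, (Fin k → m) → (Fin k → n) → Prop
  /-- The empty pivot sequence is row-pivoted. [cite: NunezFernandezEtAl2025, App. B.2] -/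
  | nil : IsRowPivoted A ![] ![]
  /-- Adjoining a pivot `(i, j)` with `0 ≠ ‖E i j‖ = max_y ‖E i y‖`, `E` the current residual.
  [cite: NunezFernandezEtAl2025, App. B.2] -/
  | cons {k : ℕ} {r : Fin k → m} {c : Fin k → n} {i : m} {j : n} :
      IsRowPivoted A r c → (A - crossInterp A r c) i j ≠ 0 →
      (∀ y, ‖(A - crossInterp A r c) i y‖ ≤ ‖(A - crossInterp A r c) i j‖) →
      IsRowPivoted A (vecCons i r) (vecCons j c)

/-- [cite: NunezFernandezEtAl2025, App. B.2 ("rook conditions"), §3.3.1]; [cite: Bebendorf2000,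
§2 Lemma 6] ROOK-PIVOTED pivot sequences: each new pivot `(i, j)` is nonzero and maximal in
modulus both in its column and in its row of the current residual `E = A - crossInterp A r c`
(the "rook conditions" `i_r = argmax |[A/A_{r-1}](·, j_r)|`, `j_r = argmax |[A/A_{r-1}](i_r, ·)|`
of partial rank-revealing LU with rook search; full pivoting — `(i, j)` maximal over the whole
residual — is the special case `IsRookPivoted.cons_of_forall`). -/
inductive IsRookPivoted (A : Matrix m n K) : ∀ {k : ℕ}, (Fin k → m) → (Fin k → n) → Prop
  /-- The empty pivot sequence is rook-pivoted. [cite: NunezFernandezEtAl2025, App. B.2] -/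
  | nil : IsRookPivoted A ![] ![]
  /-- Adjoining a pivot `(i, j)` satisfying both rook conditions.
  [cite: NunezFernandezEtAl2025, App. B.2] -/
  | cons {k : ℕ} {r : Fin k → m} {c : Fin k → n} {i : m} {j : n} :
      IsRookPivoted A r c → (A - crossInterp A r c) i j ≠ 0 →
      (∀ x, ‖(A - crossInterp A r c) x j‖ ≤ ‖(A - crossInterp A r c) i j‖) →
      (∀ y, ‖(A - crossInterp A r c) i y‖ ≤ ‖(A - crossInterp A r c) i j‖) →
      IsRookPivoted A (vecCons i r) (vecCons j c)

/-- [cite: NunezFernandezEtAl2025, §3.3.1 (full pivoting)] A FULL-PIVOTING step (the new pivot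
maximises the modulus of the whole current residual) is a rook step. -/
theorem IsRookPivoted.cons_of_forall {A : Matrix m n K} {r : Fin k → m} {c : Fin k → n}
    (h : IsRookPivoted A r c) {i : m} {j : n} (hne : (A - crossInterp A r c) i j ≠ 0)
    (hfull : ∀ x y, ‖(A - crossInterp A r c) x y‖ ≤ ‖(A - crossInterp A r c) i j‖) :
    IsRookPivoted A (vecCons i r) (vecCons j c) :=
  h.cons hne (fun x => hfull x j) fun y => hfull i y

/-- [cite: NunezFernandezEtAl2025, App. B.2] A rook-pivoted sequence is column-pivoted. -/
theorem IsRookPivoted.isColumnPivoted {A : Matrix m n K} {r : Fin k → m} {c : Fin k → n}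
    (h : IsRookPivoted A r c) : IsColumnPivoted A r c := by
  induction h with
  | nil => exact .nil
  | cons _ hne hcol _ ih => exact ih.cons hne hcol

/-- [cite: NunezFernandezEtAl2025, App. B.2] A rook-pivoted sequence is row-pivoted. -/
theorem IsRookPivoted.isRowPivoted {A : Matrix m n K} {r : Fin k → m} {c : Fin k → n}
    (h : IsRookPivoted A r c) : IsRowPivoted A r c := by
  induction h with
  | nil => exact .nil
  | cons _ hne _ hrow ih => exact ih.cons hne hrow

/-- [cite: Bebendorf2000, §2 Lemma 3, Lemma 6 (transposed)] Row pivoting for `A` is column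
pivoting for `Aᵀ` with the pivot lists swapped. -/
theorem IsRowPivoted.transpose {A : Matrix m n K} {r : Fin k → m} {c : Fin k → n}
    (h : IsRowPivoted A r c) : IsColumnPivoted Aᵀ c r := by
  induction h with
  | nil => exact .nil
  | @cons k r c i j _ hne hrow ih =>
    refine ih.cons ?_ ?_
    · rwa [transpose_sub_crossInterp_apply]
    · intro y
      rw [transpose_sub_crossInterp_apply, transpose_sub_crossInterp_apply]
      exact hrow y

/-- [cite: Bebendorf2000, §2 Lemma 3, Lemma 6 (transposed)] Column pivoting for `A` is row
pivoting for `Aᵀ` with the pivot lists swapped. -/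
theorem IsColumnPivoted.transpose {A : Matrix m n K} {r : Fin k → m} {c : Fin k → n}
    (h : IsColumnPivoted A r c) : IsRowPivoted Aᵀ c r := by
  induction h with
  | nil => exact .nil
  | @cons k r c i j _ hne hcol ih =>
    refine ih.cons ?_ ?_
    · rwa [transpose_sub_crossInterp_apply]
    · intro x
      rw [transpose_sub_crossInterp_apply, transpose_sub_crossInterp_apply]
      exact hcol x

/-- [cite: Bebendorf2000, §2 Lemma 2 (transposed)] Along a row-pivoted sequence every pivot block
is nonsingular. -/
theorem IsRowPivoted.isUnit_det {A : Matrix m n K} {r : Fin k → m} {c : Fin k → n}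
    (h : IsRowPivoted A r c) : IsUnit (A.submatrix r c).det := by
  rw [← det_transpose, transpose_submatrix]
  exact h.transpose.isUnit_det

/-- [cite: Bebendorf2000, §2 Lemma 6 (transposed)]; [cite: Steinbach2008, §14.2.3 Lemma 14.14]
THE `2^k` GROWTH BOUND FOR THE ROW COEFFICIENTS under row pivoting:
`‖(P⁻¹ A[r, :]) s y‖ ≤ 2^s`, `s` the position of the pivot counted from the newest. -/
theorem IsRowPivoted.norm_inv_submatrix_mul_apply_le_two_pow {A : Matrix m n K}
    {r : Fin k → m} {c : Fin k → n} (h : IsRowPivoted A r c) (s : Fin k) (y : n) :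
    ‖((A.submatrix r c)⁻¹ * A.submatrix r id) s y‖ ≤ 2 ^ (s : ℕ) := by
  rw [← transpose_apply ((A.submatrix r c)⁻¹ * A.submatrix r id) y s,
    transpose_inv_submatrix_mul_submatrix]
  exact h.transpose.norm_submatrix_mul_inv_apply_le_two_pow y s

/-- [cite: Bebendorf2000, §2 (6) (transposed)]; [cite: Steinbach2008, §14.2.3 Cor. 14.15]
The ACA error estimate under ROW pivoting, against any approximation `L A[r, :]` of `A` from
its pivot rows that is `δ`-accurate at `(x, y)` and at the pivot columns `(x, c l)`:
`‖(A - Ã) x y‖ ≤ 2^k · δ`. -/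
theorem IsRowPivoted.norm_sub_crossInterp_le {A : Matrix m n K} {r : Fin k → m}
    {c : Fin k → n} (h : IsRowPivoted A r c) (L : Matrix m (Fin k) K) {x : m} {y : n}
    {δ : ℝ} (hx : ‖(A - L * A.submatrix r id) x y‖ ≤ δ)
    (hc : ∀ l, ‖(A - L * A.submatrix r id) x (c l)‖ ≤ δ) :
    ‖(A - crossInterp A r c) x y‖ ≤ 2 ^ k * δ := by
  have hT : ∀ (x' : m) (y' : n),
      (Aᵀ - Aᵀ.submatrix id r * Lᵀ) y' x' = (A - L * A.submatrix r id) x' y' := by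
    intro x' y'
    rw [← transpose_submatrix, ← transpose_mul, ← transpose_sub, transpose_apply]
  rw [← transpose_sub_crossInterp_apply]
  exact h.transpose.norm_sub_crossInterp_le Lᵀ (by rw [hT]; exact hx)
    (fun l => by rw [hT]; exact hc l)

/-- [cite: NunezFernandezEtAl2025, App. B.2, §3.3.1]; [cite: Bebendorf2000, §2 Lemma 6]
Under ROOK pivoting both coefficient matrices obey the `2^k` growth bound:
`‖(A[:, c] P⁻¹) x s‖ ≤ 2^s` and `‖(P⁻¹ A[r, :]) s y‖ ≤ 2^s`. -/
theorem IsRookPivoted.norm_coeff_le_two_pow {A : Matrix m n K} {r : Fin k → m} {c : Fin k → n}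
    (h : IsRookPivoted A r c) (x : m) (s : Fin k) (y : n) :
    ‖(A.submatrix id c * (A.submatrix r c)⁻¹) x s‖ ≤ 2 ^ (s : ℕ) ∧
      ‖((A.submatrix r c)⁻¹ * A.submatrix r id) s y‖ ≤ 2 ^ (s : ℕ) :=
  ⟨h.isColumnPivoted.norm_submatrix_mul_inv_apply_le_two_pow x s,
    h.isRowPivoted.norm_inv_submatrix_mul_apply_le_two_pow s y⟩

end NormedField

end Literature.LinearAlgebra.Matrix
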